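import Summits.BirchSwinnertonDyer.BirchSwinnertonDyer.Theorems.ByReductionTypeAtTwoSupersingularConjATwoGoodSSDoor
import Summits.BirchSwinnertonDyer.BirchSwinnertonDyer.Theorems.ByReductionTypeAtTwoFineSelmerConjAAtTwoAdditivePotGoodGenusDoorCubic
import Summits.BirchSwinnertonDyer.BirchSwinnertonDyer.Theorems.ByReductionTypeAtTwoFineSelmerConjAAtTwoAdditivePotGoodGenusDoorSignature
import HarnessLib

/-!
# Route `ByReductionTypeAtTwo` (rung K4), crux `SupersingularRankZeroAtTwo` (item stmt-BirchSwinnertonDyer-19097), registry v2.12 stub 3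
# `stub_fineMu : FineMuZeroOnHabitatAtTwo`: THE GOOD-SUPERSINGULAR GENUS DOORS — Coates–Sujatha (A)₂ / `Rank1Residual.FineMuZeroAt W 2`
# ON THE MINIMAL MODEL `[0, a₂, 1, a₄, a₆]` with NO Lim fact, through the totally imaginary SEXTIC carrier `ℚ(P, √−1)`, for BOTH signs
# of `Δ_E` (a `--supports 19097` file; seat `bsd-2adic-t42` GEN 44, task T-85 «THE NARROW DOOR RE-KEY» of director-bsd (825)(ii) /
# `-imc` g33 D-imc-85; pen head `wake/SUMMON-bsd-2adic-t42-20260831T124134Z.md` @54ec3a453b2d7b88)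

HONEST LABEL (cell `bsd-2adic`, D-0036/D-0054): THEOREMS ONLY (no definition, no named fact, no `sorry`); every door is PROVED OUTRIGHT
and is conditional only on per-field KERNEL-decidable data of ONE cubic number field (class-number parity; the sign of a cubic
discriminant or two units of independent signatures). Closes nothing at the `∀`-level (stub 3 is class-wide; 19097 OPEN); nothing
booked; BSD is proved for no curve by any of this; typed ≠ proved.

WHY (the scope pass of D-imc-85, director (825)(ii)). GEN 43's door `fineMuZeroAt_two_goodSSModel_of_oddClassNumber` instantiates the
named fact `hLim2` (Lim 2017 Thm. 3.5 at `2`) at the CUBIC point field `L = ℚ(β)`; the fact's `scope_caveats` rider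
(`FineSelmerClassGroupCriterion.lean` ll. 444–461) covers `r₁(L) ≤ 1` only, so the four stamped rows with `Δ_E > 0` (`37b1`, `141e1`,
`189c1`, `189d1`: `L` totally real) consumed `hLim2` OUTSIDE its page-verified scope. The tree ALREADY holds the in-scope road, and it
needs NO Lim fact at all: the GENUS DOORS of seats k4-w1/k4-w2 (`conjA_two_of_genus_adjoin_root`, p723127 road: Chevalley's ambiguous
class number formula on `ℚ(β, √−1)/ℚ(β)` with ONE real place, p722124; `conjA_two_of_genus_adjoin_root_of_signVec_surjective`: Chevalley
WITH SIGNATURES, p724470; both then Iwasawa 1956 at the totally imaginary sextic `ℚ(β, √−1)` — ONE prime above `2`, p722472 — and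
cruxlead-19573-w2's unipotent-dévissage door p718233). This file KEYS THEM ON THE GOOD-SUPERSINGULAR MINIMAL MODEL: for
`W = [0, a₂, 1, a₄, a₆]` and a root `β` of the `2`-division cubic `X³ + 4a₂X² + 16a₄X + (64a₆ + 16)`, GEN 43 §1 gives the `2`-torsion
point `P_β = (β/4, −1/2) ≠ 0` with point field `ℚ(P_β) = ℚ(β)`, and `π = β/2` is a root of the Eisenstein cubic
`Y³ + 2a₂Y² + 4a₄Y + (8a₆ + 2)` (`4 ∤ 8a₆ + 2` for free), so `[ℚ(β) : ℚ] = 3` and `ℚ(β)` has exactly ONE prime above `2` — KERNEL.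

* §1 `finrank_adjoin_goodSSModel_root_eq_three`, `existsUnique_two_mem_adjoin_goodSSModel_root` — the cubic-field data of `ℚ(β)`.
* §2 **`conjA_two_goodSSModel_of_discr_neg`** `(a₂ a₄ a₆) (hp hq hr) [IsElliptic] (hβ) (hd : disc < 0) (hh : 2 ∤ #Cl(𝓞 ℚ(β))) (κ) (hκ)`
  — (A)₂ with NO Lim fact for `Δ_E < 0` (one real place); **`conjA_two_goodSSModel_of_signVec_surjective`** `… (hsig) (hh) (κ) (hκ)` —
  (A)₂ with NO Lim fact when the units of `ℚ(β)` take all signatures (any sign of `Δ_E`; for `Δ_E > 0` two units of independent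
  signs, `CubicFieldUnitSignatureCertificate`); `fineMuZeroAt_two_goodSSModel_of_discr_neg` / `…_of_signVec_surjective` — the
  `Rank1Residual.FineMuZeroAt · 2` currency of the registry's stub 3.
* §3 GENERATOR SWAP (GEN 43 §4 shape, keyed on a small generator `θ = u(β)`, `β = v(θ)` of `ℚ(β)`, root of an integer cubic `g`):
  **`conjA_two_goodSSModel_of_generator_of_discr_neg`** `(hswap) (hd : disc g < 0) (hodd)` and
  **`conjA_two_goodSSModel_of_generator_of_signVec_surjective`** `(hswap) (hsig) (hodd)` + `fineMuZeroAt` twins — so the row stamps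
  of GEN 43 (`…GoodSSRowStampsA/B/C`, `…KernelStamps`: kernel class-number bits on the `polredabs` cubics) re-key with NO `hLim2`.

Relation to `-imc`'s typed fix (crux workfile `Cruxes/SupersingularRankZeroAtTwo/D85NarrowDoorAtTwo.lean` b6024207f9dc8f53): K85
`D85.SexticDoorConjAAtTwo` asked for (A)₂ from `hLim2` AND the sextic bit `2 ∤ h(ℚ(β, ι))`; K85-N `D85.NarrowParityLawAtTwo` for the
equivalence with `2 ∤ h⁺(ℚ(β))`. The doors here are STRONGER on both counts: no `hLim2`, and the sextic parity is DERIVED in the kernel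
from the cubic bit plus the signature datum (Chevalley with signatures IS a tree theorem, p724470 — the «easy direction» of K85-N).

References: [CoatesSujatha2005] Conj. A, Thm. 3.4; [Greenberg2001IwasawaPastPresent] Prop. 2.1 p. 339 (Iwasawa 1956); [Lang1990] Ch. 13 §4
Lemma 4.1; [Gras2003] IV.4; [FrohlichTaylor1990] Ch. V §1 (1.12); [Cohen1993] Prop. 4.8.11, §4.1.3; [SilvermanAEC2009] VIII.§1, proof of
Prop. III.4.2(a); tree p718233, p722124, p722472, p723127, p724470, GEN 43 ★ p822499.
-/

set_option autoImplicit false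
-- sibling precedent (`…GoodSSDoor.lean`): the directory name repeats the summit name
set_option linter.dupNamespace false

noncomputable section

open scoped Classical IntermediateField NumberField

namespace Summit.BirchSwinnertonDyer.BirchSwinnertonDyer.Theorems.AddKatoTwo

open WeierstrassCurve Field Polynomial IsDedekindDomain NumberField Literature.NumberTheory.EllipticCurves
  Literature.NumberTheory.GaloisRepresentations Literature.NumberTheory.IwasawaTheory
  Literature.Geometry.Kaehler.ComplexTorus
  Summit.BirchSwinnertonDyer.BirchSwinnertonDyer.Theorems.AlignedTransportAtTwoTorsionPointField
  Summit.BirchSwinnertonDyer.BirchSwinnertonDyer.Theses.ByReductionTypeAtTwo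

/-! ## §1 The cubic-field data of `ℚ(β)`, `β` a root of the `2`-division cubic of `[0, a₂, 1, a₄, a₆]` -/

section CubicData

variable (a₂ a₄ a₆ : ℤ)

/-- The polynomial identity behind `β ↦ π = β/2`: a root `β` of `X³ + 4a₂X² + 16a₄X + (64a₆ + 16)` gives the root `π = β/2` of the
Eisenstein cubic `Y³ + 2a₂Y² + 4a₄Y + (8a₆ + 2)`, and `ℚ(π) = ℚ(β)`. [folklore] -/
theorem exists_eisenstein_root_adjoin_eq_of_goodSSModel_root {β : AlgebraicClosure ℚ}
    (hβ : aeval β (Cubic.toPoly ⟨1, ((4 * a₂ : ℤ) : ℚ), ((16 * a₄ : ℤ) : ℚ), ((64 * a₆ + 16 : ℤ) : ℚ)⟩) = 0) :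
    ∃ π : AlgebraicClosure ℚ,
      aeval π (Cubic.toPoly ⟨1, ((2 * a₂ : ℤ) : ℚ), ((4 * a₄ : ℤ) : ℚ), ((8 * a₆ + 2 : ℤ) : ℚ)⟩) = 0 ∧
        IntermediateField.adjoin ℚ {π} = IntermediateField.adjoin ℚ {β} := by
  have hβ' : β ^ 3 + (4 * (a₂ : AlgebraicClosure ℚ)) * β ^ 2 + (16 * (a₄ : AlgebraicClosure ℚ)) * β
      + (64 * (a₆ : AlgebraicClosure ℚ) + 16) = 0 := by
    have := hβ
    simp only [Cubic.toPoly, map_one, one_mul, aeval_add, aeval_mul, aeval_C, aeval_X_pow, aeval_X,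
      eq_ratCast, Rat.cast_intCast] at this
    push_cast at this
    linear_combination this
  set π : AlgebraicClosure ℚ := algebraMap ℚ (AlgebraicClosure ℚ) (1 / 2 : ℚ) * β with hπdef
  refine ⟨π, ?_, ?_⟩
  · simp only [Cubic.toPoly, map_one, one_mul, aeval_add, aeval_mul, aeval_C, aeval_X_pow, aeval_X, eq_ratCast,
      Rat.cast_intCast]
    rw [hπdef]
    simp only [eq_ratCast]
    push_cast
    linear_combination ((1 : AlgebraicClosure ℚ) / 8) * hβ'
  · apply le_antisymm
    · rw [IntermediateField.adjoin_simple_le_iff, hπdef]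
      exact mul_mem (algebraMap_mem _ _) (IntermediateField.mem_adjoin_simple_self ℚ β)
    · rw [IntermediateField.adjoin_simple_le_iff]
      have hβeq : β = algebraMap ℚ (AlgebraicClosure ℚ) (2 : ℚ) * π := by
        rw [hπdef]; simp only [eq_ratCast]; push_cast; ring
      rw [hβeq]
      exact mul_mem (algebraMap_mem _ _) (IntermediateField.mem_adjoin_simple_self ℚ π)

/-- **`[ℚ(β) : ℚ] = 3`** for every root `β ∈ ℚ̄` of the `2`-division cubic `X³ + 4a₂X² + 16a₄X + (64a₆ + 16)` of `[0, a₂, 1, a₄, a₆]`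
(no hypothesis: `π = β/2` is a root of an Eisenstein-at-`2` cubic). KERNEL. [cite: Neukirch1999, II.§6 (Eisenstein polynomials)] -/
theorem finrank_adjoin_goodSSModel_root_eq_three {β : AlgebraicClosure ℚ}
    (hβ : aeval β (Cubic.toPoly ⟨1, ((4 * a₂ : ℤ) : ℚ), ((16 * a₄ : ℤ) : ℚ), ((64 * a₆ + 16 : ℤ) : ℚ)⟩) = 0) :
    Module.finrank ℚ (IntermediateField.adjoin ℚ {β}) = 3 := by
  obtain ⟨π, hπ, hadj⟩ := exists_eisenstein_root_adjoin_eq_of_goodSSModel_root a₂ a₄ a₆ hβ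
  have hr4 : ¬ (4 : ℤ) ∣ 8 * a₆ + 2 := by omega
  rw [← hadj]
  exact finrank_adjoin_eq_three_of_eisenstein (p := 2 * a₂) (q := 4 * a₄) (r := 8 * a₆ + 2)
    (even_two_mul a₂) ⟨2 * a₄, by ring⟩ ⟨4 * a₆ + 1, by ring⟩ hr4 hπ

/-- **`ℚ(β)` has EXACTLY ONE prime above `2`** for every root `β` of the `2`-division cubic of `[0, a₂, 1, a₄, a₆]` (Eisenstein criterion
for `π = β/2`: `2 = 𝔮³`). KERNEL. [cite: Neukirch1999, II.§6 (Eisenstein polynomials)] -/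
theorem existsUnique_two_mem_adjoin_goodSSModel_root {β : AlgebraicClosure ℚ}
    (hβ : aeval β (Cubic.toPoly ⟨1, ((4 * a₂ : ℤ) : ℚ), ((16 * a₄ : ℤ) : ℚ), ((64 * a₆ + 16 : ℤ) : ℚ)⟩) = 0) :
    ∃! v : HeightOneSpectrum (𝓞 (IntermediateField.adjoin ℚ {β})),
      ((2 : ℕ) : 𝓞 (IntermediateField.adjoin ℚ {β})) ∈ v.asIdeal := by
  obtain ⟨π, hπ, hadj⟩ := exists_eisenstein_root_adjoin_eq_of_goodSSModel_root a₂ a₄ a₆ hβ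
  have hr4 : ¬ (4 : ℤ) ∣ 8 * a₆ + 2 := by omega
  rw [← hadj]
  exact existsUnique_two_mem_adjoin_of_eisenstein (p := 2 * a₂) (q := 4 * a₄) (r := 8 * a₆ + 2)
    (even_two_mul a₂) ⟨2 * a₄, by ring⟩ ⟨4 * a₆ + 1, by ring⟩ hr4 hπ

end CubicData

/-! ## §2 The genus doors on the minimal model `[0, a₂, 1, a₄, a₆]` — NO Lim fact -/

section Doors

/-- **GOOD-SUPERSINGULAR GENUS DOOR, `Δ_E < 0` (one real place) — NO Lim fact.** For integers `a₂ a₄ a₆` with `W = [0, a₂, 1, a₄, a₆]`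
elliptic, `(p, q, r) = (4a₂, 16a₄, 64a₆ + 16)`, a root `β` of `X³ + pX² + qX + r` with NEGATIVE discriminant (equivalently `Δ_E < 0`:
`256·Δ_E = disc`), and the ONE bit `2 ∤ #Cl(𝓞 ℚ(β))`: statement (A)₂(W) (`∃ γ D`). KERNEL composition: GEN 43 §1 (point field
`ℚ(P_β) = ℚ(β)`, `P_β ≠ 0`), §1 above (`[ℚ(β):ℚ] = 3`, one prime above `2`), and k4-w1's `conjA_two_of_genus_adjoin_root` (one real place
from `disc < 0`; Chevalley on `ℚ(β, √−1)/ℚ(β)`; Iwasawa 1956; w2's door). No named fact is consumed.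
[cite: CoatesSujatha2005, Conj. A and Thm. 3.4] [cite: Greenberg2001IwasawaPastPresent, Prop. 2.1 p. 339] [cite: Cohen1993, Prop. 4.8.11] -/
theorem conjA_two_goodSSModel_of_discr_neg
    (a₂ a₄ a₆ : ℤ) {p q r : ℤ} (hp : p = 4 * a₂) (hq : q = 16 * a₄) (hr : r = 64 * a₆ + 16)
    [((⟨0, a₂, 1, a₄, a₆⟩ : WeierstrassCurve ℤ).baseChange ℚ).IsElliptic]
    {β : AlgebraicClosure ℚ} (hβ : aeval β (Cubic.toPoly ⟨1, (p : ℚ), (q : ℚ), (r : ℚ)⟩) = 0)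
    (hd : Cubic.discr ⟨1, (p : ℚ), (q : ℚ), (r : ℚ)⟩ < 0)
    (hh : ¬ 2 ∣ Nat.card (ClassGroup (𝓞 (IntermediateField.adjoin ℚ {β}))))
    (κ : ZpExtension ℚ 2) (hκ : κ.IsCyclotomic) :
    ∃ (γ : absoluteGaloisGroup ℚ)
      (D : ((⟨0, a₂, 1, a₄, a₆⟩ : WeierstrassCurve ℤ).baseChange ℚ).FineSelmerDualData κ γ),
      Module.Finite ℤ_[2] (RestrictScalars ℤ_[2] (IwasawaAlgebra 2) D.X) := by
  subst hp hq hr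
  obtain ⟨P₀, hP₀, hP₀eq⟩ := exists_geomTorsion_two_goodSSModel_eq_some a₂ a₄ a₆ hβ
  exact conjA_two_of_genus_adjoin_root _ hP₀ hβ (finrank_adjoin_goodSSModel_root_eq_three a₂ a₄ a₆ hβ) hd
    (fixedField_stabilizer_goodSSModel_eq_adjoin_root a₂ a₄ a₆ hβ hP₀eq) hh
    (existsUnique_two_mem_adjoin_goodSSModel_root a₂ a₄ a₆ hβ) κ hκ

/-- **GOOD-SUPERSINGULAR SIGNATURE GENUS DOOR — NO Lim fact, either sign of `Δ_E`.** For integers `a₂ a₄ a₆` with `W = [0, a₂, 1, a₄, a₆]`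
elliptic, `(p, q, r) = (4a₂, 16a₄, 64a₆ + 16)`, a root `β` of `X³ + pX² + qX + r`: if the unit signature map of `ℚ(β)` is ONTO
(`ComplexTorus.signVec`; automatic up to `−1` when `Δ_E < 0`, two units of independent signs when `Δ_E > 0`) and `2 ∤ #Cl(𝓞 ℚ(β))`, then
statement (A)₂(W) (`∃ γ D`). KERNEL composition: GEN 43 §1, §1 above, and k4-w1's `conjA_two_of_genus_adjoin_root_of_signVec_surjective`
(Chevalley WITH SIGNATURES on `ℚ(β, √−1)/ℚ(β)`, p724470; Iwasawa 1956; w2's door). No named fact is consumed.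
[cite: CoatesSujatha2005, Conj. A and Thm. 3.4] [cite: Greenberg2001IwasawaPastPresent, Prop. 2.1 p. 339]
[cite: FrohlichTaylor1990, Ch. V §1 (1.12), p. 164] -/
theorem conjA_two_goodSSModel_of_signVec_surjective
    (a₂ a₄ a₆ : ℤ) {p q r : ℤ} (hp : p = 4 * a₂) (hq : q = 16 * a₄) (hr : r = 64 * a₆ + 16)
    [((⟨0, a₂, 1, a₄, a₆⟩ : WeierstrassCurve ℤ).baseChange ℚ).IsElliptic]
    {β : AlgebraicClosure ℚ} (hβ : aeval β (Cubic.toPoly ⟨1, (p : ℚ), (q : ℚ), (r : ℚ)⟩) = 0)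
    (hsig : ∀ [NumberField (IntermediateField.adjoin ℚ {β})],
      Function.Surjective (signVec (K := ↥(IntermediateField.adjoin ℚ {β}))))
    (hh : ¬ 2 ∣ Nat.card (ClassGroup (𝓞 (IntermediateField.adjoin ℚ {β}))))
    (κ : ZpExtension ℚ 2) (hκ : κ.IsCyclotomic) :
    ∃ (γ : absoluteGaloisGroup ℚ)
      (D : ((⟨0, a₂, 1, a₄, a₆⟩ : WeierstrassCurve ℤ).baseChange ℚ).FineSelmerDualData κ γ),
      Module.Finite ℤ_[2] (RestrictScalars ℤ_[2] (IwasawaAlgebra 2) D.X) := by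
  subst hp hq hr
  obtain ⟨P₀, hP₀, hP₀eq⟩ := exists_geomTorsion_two_goodSSModel_eq_some a₂ a₄ a₆ hβ
  exact conjA_two_of_genus_adjoin_root_of_signVec_surjective _ hP₀ hβ
    (finrank_adjoin_goodSSModel_root_eq_three a₂ a₄ a₆ hβ)
    (fixedField_stabilizer_goodSSModel_eq_adjoin_root a₂ a₄ a₆ hβ hP₀eq) hsig hh
    (existsUnique_two_mem_adjoin_goodSSModel_root a₂ a₄ a₆ hβ) κ hκ

/-- **`FineMuZeroAt ([0, a₂, 1, a₄, a₆] ⊗ ℚ) 2` with NO Lim fact, `Δ_E < 0`** (one bit: `2 ∤ #Cl(𝓞 ℚ(β))`) — the currency of the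
registry's stub 3 `FineMuZeroOnHabitatAtTwo`. [cite: CoatesSujatha2005, Conj. A and Thm. 3.4] [cite: Greenberg2001IwasawaPastPresent, Prop. 2.1 p. 339] -/
theorem fineMuZeroAt_two_goodSSModel_of_discr_neg
    (a₂ a₄ a₆ : ℤ) {p q r : ℤ} (hp : p = 4 * a₂) (hq : q = 16 * a₄) (hr : r = 64 * a₆ + 16)
    [((⟨0, a₂, 1, a₄, a₆⟩ : WeierstrassCurve ℤ).baseChange ℚ).IsElliptic]
    {β : AlgebraicClosure ℚ} (hβ : aeval β (Cubic.toPoly ⟨1, (p : ℚ), (q : ℚ), (r : ℚ)⟩) = 0)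
    (hd : Cubic.discr ⟨1, (p : ℚ), (q : ℚ), (r : ℚ)⟩ < 0)
    (hh : ¬ 2 ∣ Nat.card (ClassGroup (𝓞 (IntermediateField.adjoin ℚ {β})))) :
    Literature.NumberTheory.EllipticCurves.Rank1Residual.FineMuZeroAt
      ((⟨0, a₂, 1, a₄, a₆⟩ : WeierstrassCurve ℤ).baseChange ℚ) 2 :=
  Literature.NumberTheory.EllipticCurves.Rank1Residual.ConjAAt.fineMuZeroAt
    (fun κ hκ ↦ conjA_two_goodSSModel_of_discr_neg a₂ a₄ a₆ hp hq hr hβ hd hh κ hκ)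

/-- **`FineMuZeroAt ([0, a₂, 1, a₄, a₆] ⊗ ℚ) 2` with NO Lim fact from the unit signatures of `ℚ(β)`** (either sign of `Δ_E`) and the bit
`2 ∤ #Cl(𝓞 ℚ(β))`. [cite: CoatesSujatha2005, Conj. A and Thm. 3.4] [cite: FrohlichTaylor1990, Ch. V §1 (1.12), p. 164] -/
theorem fineMuZeroAt_two_goodSSModel_of_signVec_surjective
    (a₂ a₄ a₆ : ℤ) {p q r : ℤ} (hp : p = 4 * a₂) (hq : q = 16 * a₄) (hr : r = 64 * a₆ + 16)
    [((⟨0, a₂, 1, a₄, a₆⟩ : WeierstrassCurve ℤ).baseChange ℚ).IsElliptic]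
    {β : AlgebraicClosure ℚ} (hβ : aeval β (Cubic.toPoly ⟨1, (p : ℚ), (q : ℚ), (r : ℚ)⟩) = 0)
    (hsig : ∀ [NumberField (IntermediateField.adjoin ℚ {β})],
      Function.Surjective (signVec (K := ↥(IntermediateField.adjoin ℚ {β}))))
    (hh : ¬ 2 ∣ Nat.card (ClassGroup (𝓞 (IntermediateField.adjoin ℚ {β})))) :
    Literature.NumberTheory.EllipticCurves.Rank1Residual.FineMuZeroAt
      ((⟨0, a₂, 1, a₄, a₆⟩ : WeierstrassCurve ℤ).baseChange ℚ) 2 :=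
  Literature.NumberTheory.EllipticCurves.Rank1Residual.ConjAAt.fineMuZeroAt
    (fun κ hκ ↦ conjA_two_goodSSModel_of_signVec_surjective a₂ a₄ a₆ hp hq hr hβ hsig hh κ hκ)

end Doors

/-! ## §3 GENERATOR SWAP: the doors keyed on a small generator `θ` of `ℚ(β)` (root of an integer cubic `g`) — NO Lim fact -/

section GeneratorSwap

/-- The generator-swap bookkeeping of GEN 43 §4, isolated: from the swap data, a root `β` of the `2`-division cubic yields the root
`θ = u₀ + u₁β + u₂β²` of `g` with `ℚ(θ) = ℚ(β)`. [folklore] -/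
theorem exists_generator_adjoin_eq_of_swap (a₂ a₄ a₆ : ℤ) (p' q' r' : ℤ) (u₀ u₁ u₂ v₀ v₁ v₂ : ℚ)
    (hswap : ∀ β θ : AlgebraicClosure ℚ,
      β ^ 3 + ((4 * a₂ : ℤ) : AlgebraicClosure ℚ) * β ^ 2 + ((16 * a₄ : ℤ) : AlgebraicClosure ℚ) * β
          + ((64 * a₆ + 16 : ℤ) : AlgebraicClosure ℚ) = 0 →
      θ = (u₀ : AlgebraicClosure ℚ) + (u₁ : AlgebraicClosure ℚ) * β + (u₂ : AlgebraicClosure ℚ) * β ^ 2 →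
        θ ^ 3 + (p' : AlgebraicClosure ℚ) * θ ^ 2 + (q' : AlgebraicClosure ℚ) * θ + (r' : AlgebraicClosure ℚ) = 0 ∧
          β = (v₀ : AlgebraicClosure ℚ) + (v₁ : AlgebraicClosure ℚ) * θ + (v₂ : AlgebraicClosure ℚ) * θ ^ 2)
    {β : AlgebraicClosure ℚ}
    (hβ : aeval β (Cubic.toPoly ⟨1, ((4 * a₂ : ℤ) : ℚ), ((16 * a₄ : ℤ) : ℚ), ((64 * a₆ + 16 : ℤ) : ℚ)⟩) = 0) :
    ∃ θ : AlgebraicClosure ℚ, aeval θ (Cubic.toPoly ⟨1, (p' : ℚ), (q' : ℚ), (r' : ℚ)⟩) = 0 ∧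
      IntermediateField.adjoin ℚ {θ} = IntermediateField.adjoin ℚ {β} := by
  have hβ' := hβ
  simp only [Cubic.toPoly, map_one, one_mul, aeval_add, aeval_mul, aeval_C, aeval_X_pow, aeval_X, eq_ratCast,
    Rat.cast_intCast] at hβ'
  set θ : AlgebraicClosure ℚ := (u₀ : AlgebraicClosure ℚ) + (u₁ : AlgebraicClosure ℚ) * β + (u₂ : AlgebraicClosure ℚ) * β ^ 2
    with hθdef
  obtain ⟨hθ', hβeq⟩ := hswap β θ hβ' hθdef
  have hθ : aeval θ (Cubic.toPoly ⟨1, (p' : ℚ), (q' : ℚ), (r' : ℚ)⟩) = 0 := by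
    simp only [Cubic.toPoly, map_one, one_mul, aeval_add, aeval_mul, aeval_C, aeval_X_pow, aeval_X, eq_ratCast,
      Rat.cast_intCast]
    exact hθ'
  have hcast : ∀ u : ℚ, (u : AlgebraicClosure ℚ) = algebraMap ℚ (AlgebraicClosure ℚ) u := fun u ↦ (eq_ratCast _ u).symm
  have hmem : ∀ (x y : AlgebraicClosure ℚ) (w₀ w₁ w₂ : ℚ), y ∈ IntermediateField.adjoin ℚ {x} →
      (w₀ : AlgebraicClosure ℚ) + (w₁ : AlgebraicClosure ℚ) * y + (w₂ : AlgebraicClosure ℚ) * y ^ 2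
        ∈ IntermediateField.adjoin ℚ {x} := fun x y w₀ w₁ w₂ hy ↦ by
    rw [hcast w₀, hcast w₁, hcast w₂]
    exact add_mem (add_mem (algebraMap_mem _ _) (mul_mem (algebraMap_mem _ _) hy)) (mul_mem (algebraMap_mem _ _) (pow_mem hy 2))
  refine ⟨θ, hθ, ?_⟩
  apply le_antisymm <;> rw [IntermediateField.adjoin_simple_le_iff]
  · exact hmem β β u₀ u₁ u₂ (IntermediateField.mem_adjoin_simple_self ℚ β)
  · rw [hβeq]; exact hmem θ θ v₀ v₁ v₂ (IntermediateField.mem_adjoin_simple_self ℚ θ)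

/-- **(A)₂ on the minimal model with NO Lim fact from a generator swap, `Δ_E < 0`.** Data as in GEN 43's
`conjA_two_goodSSModel_of_generator` (row `[0, a₂, 1, a₄, a₆]`; integer cubic `g = X³ + p′X² + q′X + r′`; `θ = u(β)`, `β = v(θ)`)
plus the decidable sign `disc g < 0` — and `2 ∤ #Cl(𝓞 ℚ(θ))` for every root `θ` of `g` (kernel certificates). Conclusion: (A)₂(W) with
NO hypothesis left displayed and NO named fact: the door `conjA_two_of_genus_adjoin_root` is keyed on `g` and `θ` (`ℚ(P_β) = ℚ(β) =
ℚ(θ)`, `[ℚ(θ):ℚ] = 3`, one prime above `2` transported from `ℚ(β)`). [cite: CoatesSujatha2005, Conj. A and Thm. 3.4]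
[cite: Greenberg2001IwasawaPastPresent, Prop. 2.1 p. 339] [cite: Cohen1993, Prop. 4.8.11] -/
theorem conjA_two_goodSSModel_of_generator_of_discr_neg
    (a₂ a₄ a₆ : ℤ) [((⟨0, a₂, 1, a₄, a₆⟩ : WeierstrassCurve ℤ).baseChange ℚ).IsElliptic]
    (p' q' r' : ℤ) (u₀ u₁ u₂ v₀ v₁ v₂ : ℚ)
    (hswap : ∀ β θ : AlgebraicClosure ℚ,
      β ^ 3 + ((4 * a₂ : ℤ) : AlgebraicClosure ℚ) * β ^ 2 + ((16 * a₄ : ℤ) : AlgebraicClosure ℚ) * β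
          + ((64 * a₆ + 16 : ℤ) : AlgebraicClosure ℚ) = 0 →
      θ = (u₀ : AlgebraicClosure ℚ) + (u₁ : AlgebraicClosure ℚ) * β + (u₂ : AlgebraicClosure ℚ) * β ^ 2 →
        θ ^ 3 + (p' : AlgebraicClosure ℚ) * θ ^ 2 + (q' : AlgebraicClosure ℚ) * θ + (r' : AlgebraicClosure ℚ) = 0 ∧
          β = (v₀ : AlgebraicClosure ℚ) + (v₁ : AlgebraicClosure ℚ) * θ + (v₂ : AlgebraicClosure ℚ) * θ ^ 2)
    (hd : Cubic.discr ⟨1, (p' : ℚ), (q' : ℚ), (r' : ℚ)⟩ < 0)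
    (hodd : ∀ θ : AlgebraicClosure ℚ, aeval θ (Cubic.toPoly ⟨1, (p' : ℚ), (q' : ℚ), (r' : ℚ)⟩) = 0 →
      ¬ 2 ∣ Nat.card (ClassGroup (𝓞 (IntermediateField.adjoin ℚ {θ}))))
    (κ : ZpExtension ℚ 2) (hκ : κ.IsCyclotomic) :
    ∃ (γ : absoluteGaloisGroup ℚ)
      (D : ((⟨0, a₂, 1, a₄, a₆⟩ : WeierstrassCurve ℤ).baseChange ℚ).FineSelmerDualData κ γ),
      Module.Finite ℤ_[2] (RestrictScalars ℤ_[2] (IwasawaAlgebra 2) D.X) := by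
  obtain ⟨β, hβ⟩ := IsAlgClosed.exists_aeval_eq_zero (AlgebraicClosure ℚ)
    (Cubic.toPoly ⟨1, ((4 * a₂ : ℤ) : ℚ), ((16 * a₄ : ℤ) : ℚ), ((64 * a₆ + 16 : ℤ) : ℚ)⟩)
    (by rw [Cubic.degree_of_a_ne_zero one_ne_zero]; norm_num)
  obtain ⟨θ, hθ, hadj⟩ := exists_generator_adjoin_eq_of_swap a₂ a₄ a₆ p' q' r' u₀ u₁ u₂ v₀ v₁ v₂ hswap hβ
  obtain ⟨P₀, hP₀, hP₀eq⟩ := exists_geomTorsion_two_goodSSModel_eq_some a₂ a₄ a₆ hβ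
  have hF : IntermediateField.fixedField (MulAction.stabilizer (absoluteGaloisGroup ℚ) P₀) =
      IntermediateField.adjoin ℚ {θ} := by
    rw [fixedField_stabilizer_goodSSModel_eq_adjoin_root a₂ a₄ a₆ hβ hP₀eq, hadj]
  have h3 : Module.finrank ℚ (IntermediateField.adjoin ℚ {θ}) = 3 := by
    rw [hadj]; exact finrank_adjoin_goodSSModel_root_eq_three a₂ a₄ a₆ hβ
  have hv : ∃! v : HeightOneSpectrum (𝓞 (IntermediateField.adjoin ℚ {θ})),
      ((2 : ℕ) : 𝓞 (IntermediateField.adjoin ℚ {θ})) ∈ v.asIdeal := by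
    rw [hadj]; exact existsUnique_two_mem_adjoin_goodSSModel_root a₂ a₄ a₆ hβ
  exact conjA_two_of_genus_adjoin_root _ hP₀ hθ h3 hd hF (hodd θ hθ) hv κ hκ

/-- **(A)₂ on the minimal model with NO Lim fact from a generator swap and UNIT SIGNATURES** (either sign of `Δ_E`; for the totally real
rows `Δ_E > 0`). Data: the swap (`g`, `u`, `v`) as in GEN 43 §4; for every root `θ` of `g`: the unit signature map of `ℚ(θ)` is onto
(kernel certificate: three root intervals + two units, `CubicFieldUnitSignatureCertificate`) and `2 ∤ #Cl(𝓞 ℚ(θ))`. Conclusion: (A)₂(W),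
nothing displayed, no named fact. [cite: CoatesSujatha2005, Conj. A and Thm. 3.4] [cite: Greenberg2001IwasawaPastPresent, Prop. 2.1 p. 339]
[cite: FrohlichTaylor1990, Ch. V §1 (1.12), p. 164] -/
theorem conjA_two_goodSSModel_of_generator_of_signVec_surjective
    (a₂ a₄ a₆ : ℤ) [((⟨0, a₂, 1, a₄, a₆⟩ : WeierstrassCurve ℤ).baseChange ℚ).IsElliptic]
    (p' q' r' : ℤ) (u₀ u₁ u₂ v₀ v₁ v₂ : ℚ)
    (hswap : ∀ β θ : AlgebraicClosure ℚ,
      β ^ 3 + ((4 * a₂ : ℤ) : AlgebraicClosure ℚ) * β ^ 2 + ((16 * a₄ : ℤ) : AlgebraicClosure ℚ) * β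
          + ((64 * a₆ + 16 : ℤ) : AlgebraicClosure ℚ) = 0 →
      θ = (u₀ : AlgebraicClosure ℚ) + (u₁ : AlgebraicClosure ℚ) * β + (u₂ : AlgebraicClosure ℚ) * β ^ 2 →
        θ ^ 3 + (p' : AlgebraicClosure ℚ) * θ ^ 2 + (q' : AlgebraicClosure ℚ) * θ + (r' : AlgebraicClosure ℚ) = 0 ∧
          β = (v₀ : AlgebraicClosure ℚ) + (v₁ : AlgebraicClosure ℚ) * θ + (v₂ : AlgebraicClosure ℚ) * θ ^ 2)
    (hsig : ∀ θ : AlgebraicClosure ℚ, aeval θ (Cubic.toPoly ⟨1, (p' : ℚ), (q' : ℚ), (r' : ℚ)⟩) = 0 →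
      ∀ [NumberField (IntermediateField.adjoin ℚ {θ})],
        Function.Surjective (signVec (K := ↥(IntermediateField.adjoin ℚ {θ}))))
    (hodd : ∀ θ : AlgebraicClosure ℚ, aeval θ (Cubic.toPoly ⟨1, (p' : ℚ), (q' : ℚ), (r' : ℚ)⟩) = 0 →
      ¬ 2 ∣ Nat.card (ClassGroup (𝓞 (IntermediateField.adjoin ℚ {θ}))))
    (κ : ZpExtension ℚ 2) (hκ : κ.IsCyclotomic) :
    ∃ (γ : absoluteGaloisGroup ℚ)
      (D : ((⟨0, a₂, 1, a₄, a₆⟩ : WeierstrassCurve ℤ).baseChange ℚ).FineSelmerDualData κ γ),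
      Module.Finite ℤ_[2] (RestrictScalars ℤ_[2] (IwasawaAlgebra 2) D.X) := by
  obtain ⟨β, hβ⟩ := IsAlgClosed.exists_aeval_eq_zero (AlgebraicClosure ℚ)
    (Cubic.toPoly ⟨1, ((4 * a₂ : ℤ) : ℚ), ((16 * a₄ : ℤ) : ℚ), ((64 * a₆ + 16 : ℤ) : ℚ)⟩)
    (by rw [Cubic.degree_of_a_ne_zero one_ne_zero]; norm_num)
  obtain ⟨θ, hθ, hadj⟩ := exists_generator_adjoin_eq_of_swap a₂ a₄ a₆ p' q' r' u₀ u₁ u₂ v₀ v₁ v₂ hswap hβ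
  obtain ⟨P₀, hP₀, hP₀eq⟩ := exists_geomTorsion_two_goodSSModel_eq_some a₂ a₄ a₆ hβ
  have hF : IntermediateField.fixedField (MulAction.stabilizer (absoluteGaloisGroup ℚ) P₀) =
      IntermediateField.adjoin ℚ {θ} := by
    rw [fixedField_stabilizer_goodSSModel_eq_adjoin_root a₂ a₄ a₆ hβ hP₀eq, hadj]
  have h3 : Module.finrank ℚ (IntermediateField.adjoin ℚ {θ}) = 3 := by
    rw [hadj]; exact finrank_adjoin_goodSSModel_root_eq_three a₂ a₄ a₆ hβ
  have hv : ∃! v : HeightOneSpectrum (𝓞 (IntermediateField.adjoin ℚ {θ})),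
      ((2 : ℕ) : 𝓞 (IntermediateField.adjoin ℚ {θ})) ∈ v.asIdeal := by
    rw [hadj]; exact existsUnique_two_mem_adjoin_goodSSModel_root a₂ a₄ a₆ hβ
  exact conjA_two_of_genus_adjoin_root_of_signVec_surjective _ hP₀ hθ h3 hF (hsig θ hθ) (hodd θ hθ) hv κ hκ

/-- **`FineMuZeroAt ([0, a₂, 1, a₄, a₆] ⊗ ℚ) 2`, NO Lim fact, generator swap, `Δ_E < 0`.** [cite: CoatesSujatha2005, Conj. A and Thm. 3.4]
[cite: Greenberg2001IwasawaPastPresent, Prop. 2.1 p. 339] -/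
theorem fineMuZeroAt_two_goodSSModel_of_generator_of_discr_neg
    (a₂ a₄ a₆ : ℤ) [((⟨0, a₂, 1, a₄, a₆⟩ : WeierstrassCurve ℤ).baseChange ℚ).IsElliptic]
    (p' q' r' : ℤ) (u₀ u₁ u₂ v₀ v₁ v₂ : ℚ)
    (hswap : ∀ β θ : AlgebraicClosure ℚ,
      β ^ 3 + ((4 * a₂ : ℤ) : AlgebraicClosure ℚ) * β ^ 2 + ((16 * a₄ : ℤ) : AlgebraicClosure ℚ) * β
          + ((64 * a₆ + 16 : ℤ) : AlgebraicClosure ℚ) = 0 →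
      θ = (u₀ : AlgebraicClosure ℚ) + (u₁ : AlgebraicClosure ℚ) * β + (u₂ : AlgebraicClosure ℚ) * β ^ 2 →
        θ ^ 3 + (p' : AlgebraicClosure ℚ) * θ ^ 2 + (q' : AlgebraicClosure ℚ) * θ + (r' : AlgebraicClosure ℚ) = 0 ∧
          β = (v₀ : AlgebraicClosure ℚ) + (v₁ : AlgebraicClosure ℚ) * θ + (v₂ : AlgebraicClosure ℚ) * θ ^ 2)
    (hd : Cubic.discr ⟨1, (p' : ℚ), (q' : ℚ), (r' : ℚ)⟩ < 0)
    (hodd : ∀ θ : AlgebraicClosure ℚ, aeval θ (Cubic.toPoly ⟨1, (p' : ℚ), (q' : ℚ), (r' : ℚ)⟩) = 0 →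
      ¬ 2 ∣ Nat.card (ClassGroup (𝓞 (IntermediateField.adjoin ℚ {θ})))) :
    Literature.NumberTheory.EllipticCurves.Rank1Residual.FineMuZeroAt
      ((⟨0, a₂, 1, a₄, a₆⟩ : WeierstrassCurve ℤ).baseChange ℚ) 2 :=
  Literature.NumberTheory.EllipticCurves.Rank1Residual.ConjAAt.fineMuZeroAt
    (fun κ hκ ↦ conjA_two_goodSSModel_of_generator_of_discr_neg a₂ a₄ a₆ p' q' r' u₀ u₁ u₂ v₀ v₁ v₂ hswap hd hodd κ hκ)

/-- **`FineMuZeroAt ([0, a₂, 1, a₄, a₆] ⊗ ℚ) 2`, NO Lim fact, generator swap, unit signatures.** [cite: CoatesSujatha2005, Conj. A and Thm. 3.4]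
[cite: FrohlichTaylor1990, Ch. V §1 (1.12), p. 164] -/
theorem fineMuZeroAt_two_goodSSModel_of_generator_of_signVec_surjective
    (a₂ a₄ a₆ : ℤ) [((⟨0, a₂, 1, a₄, a₆⟩ : WeierstrassCurve ℤ).baseChange ℚ).IsElliptic]
    (p' q' r' : ℤ) (u₀ u₁ u₂ v₀ v₁ v₂ : ℚ)
    (hswap : ∀ β θ : AlgebraicClosure ℚ,
      β ^ 3 + ((4 * a₂ : ℤ) : AlgebraicClosure ℚ) * β ^ 2 + ((16 * a₄ : ℤ) : AlgebraicClosure ℚ) * β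
          + ((64 * a₆ + 16 : ℤ) : AlgebraicClosure ℚ) = 0 →
      θ = (u₀ : AlgebraicClosure ℚ) + (u₁ : AlgebraicClosure ℚ) * β + (u₂ : AlgebraicClosure ℚ) * β ^ 2 →
        θ ^ 3 + (p' : AlgebraicClosure ℚ) * θ ^ 2 + (q' : AlgebraicClosure ℚ) * θ + (r' : AlgebraicClosure ℚ) = 0 ∧
          β = (v₀ : AlgebraicClosure ℚ) + (v₁ : AlgebraicClosure ℚ) * θ + (v₂ : AlgebraicClosure ℚ) * θ ^ 2)
    (hsig : ∀ θ : AlgebraicClosure ℚ, aeval θ (Cubic.toPoly ⟨1, (p' : ℚ), (q' : ℚ), (r' : ℚ)⟩) = 0 →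
      ∀ [NumberField (IntermediateField.adjoin ℚ {θ})],
        Function.Surjective (signVec (K := ↥(IntermediateField.adjoin ℚ {θ}))))
    (hodd : ∀ θ : AlgebraicClosure ℚ, aeval θ (Cubic.toPoly ⟨1, (p' : ℚ), (q' : ℚ), (r' : ℚ)⟩) = 0 →
      ¬ 2 ∣ Nat.card (ClassGroup (𝓞 (IntermediateField.adjoin ℚ {θ})))) :
    Literature.NumberTheory.EllipticCurves.Rank1Residual.FineMuZeroAt
      ((⟨0, a₂, 1, a₄, a₆⟩ : WeierstrassCurve ℤ).baseChange ℚ) 2 :=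
  Literature.NumberTheory.EllipticCurves.Rank1Residual.ConjAAt.fineMuZeroAt
    (fun κ hκ ↦ conjA_two_goodSSModel_of_generator_of_signVec_surjective a₂ a₄ a₆ p' q' r' u₀ u₁ u₂ v₀ v₁ v₂ hswap
      hsig hodd κ hκ)

end GeneratorSwap

end Summit.BirchSwinnertonDyer.BirchSwinnertonDyer.Theorems.AddKatoTwo

end
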